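import Literature.FieldTheory.Galois.FixingSubgroupInfimumComplex
import Literature.FieldTheory.AlgClosed.AutComplexGeneratedBySubfields
import Mathlib.SetTheory.Cardinal.Basic
import HarnessLib

/-!
# The Galois hull of a finite family of number fields inside `ℂ`, as a finite Galois layer over their intersection:
# the field-theoretic binders of Deligne's descent to the intersection ([Deligne 1971] Prop. 5.10, Lemme 5.10.1)

Topic `Literature/FieldTheory/Galois`, namespace `Literature.FieldTheory.Galois`.  THEOREMS + two plumbing definitions with bodies
(`Complex.inclExtendScalars`, an inclusion ring homomorphism; `Complex.traceFixingSubgroup`, a Mathlib `fixingSubgroup`); no named fact,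
no instance (net debt 0).  Cell `hodgecm-mathlib` (D-0151), row I-6 `descentToIntersection_printed` `_holds` programme, CREW MAP v3
piece **D4-fields** (lead A-p08): for `Ei : ι → IntermediateField ℚ ℂ` (finite, nonempty, each finite over `ℚ`) and `E := ⨅ i, Ei i`,
everything the algebraic half needs about the finite Galois layer `L := ↥(extendScalars hEE′)` of a Galois hull `E′` over `k := ↥E`:
* §1 the hull: `Complex.exists_hull` — `∃ E′, E ≤ E′ ∧ (∀ i, Ei i ≤ E′) ∧ FiniteDimensional ℚ E′ ∧ IsGalois ℚ E′`;
* §2 the layer `L` over `k`: finite, Galois (re-exported from `FixingSubgroupInfimumComplex`), COUNTABLE (`#L ≤ ℵ₀`);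
* §3 the middle inclusions `incl i : ↥(Ei i) →+* L` with `((incl i x : L) : ℂ) = x`, the equation `algebraMap`-style facts one needs to
  install them as `toAlgebra` with `IsScalarTower ↥(Ei i) L ℂ` (stated, not installed);
* §4 the subgroups `H i ≤ Gal(L/k)` fixing `incl i`-images (= Mathlib `fixingSubgroup` of the trace `Ei i ∩ E′`), their membership
  criterion, and **`⨆ i, H i = ⊤`** ([Deligne1971] «`Gal(F/E)` est engendré par les `Gal(F/Eᵢ)`»);
* §5 `hext`: every `γ ∈ Gal(L/k)` extends to a ring automorphism of `ℂ` (P0, `Complex.exists_ringEquiv_apply_eq_extendScalars`);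
  `hres`: every `σ̃ ∈ Aut(ℂ/k)` restricts to some `γ ∈ Gal(L/k)` (`E′/ℚ` normal, Mathlib `AlgEquiv.restrictNormal`).

## References
* [Deligne1971TravauxShimura] P. Deligne, *Travaux de Shimura*, Sém. Bourbaki 389 (1971), Prop. 5.10 and Lemme 5.10.1 (pp. 157–158).
* [Lang2002] S. Lang, *Algebra*, Ch. V §3 (normal closure, restriction to a normal subextension), Ch. VI §1 Thm. 1.10, Cor. 1.6;
  Ch. VIII §1 (extension of automorphisms to an algebraically closed overfield).
-/

set_option autoImplicit false

noncomputable section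

open Cardinal IntermediateField

namespace Literature.FieldTheory.Galois

section Hull

variable {ι : Type*} [Finite ι] [Nonempty ι] (Ei : ι → IntermediateField ℚ ℂ) [∀ i, FiniteDimensional ℚ (Ei i)]

/-- **The Galois hull of finitely many number fields inside `ℂ`, over their intersection**: there is a finite Galois extension
`E′/ℚ` inside `ℂ` containing every `Eᵢ`, hence `⨅ Eᵢ ≤ E′` ([Deligne1971TravauxShimura] Prop. 5.10 proof: «soit `F` l'extension de `E`
dans `ℂ` qu'ils engendrent» — any finite Galois `E′ ⊇ F` does). [cite: Deligne1971TravauxShimura, Prop. 5.10 proof (p. 157)]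
[cite: Lang2002, Ch. V §3 and Ch. VI §1 Thm. 1.10] -/
theorem Complex.exists_hull :
    ∃ E' : IntermediateField ℚ ℂ, (⨅ i, Ei i) ≤ E' ∧ (∀ i, Ei i ≤ E') ∧ FiniteDimensional ℚ E' ∧ IsGalois ℚ E' := by
  obtain ⟨E', h₁, h₂, h₃, h₄⟩ := Complex.exists_intermediateField_isGalois_iInf_le_forall_le Ei
  exact ⟨E', h₃, h₄, h₁, h₂⟩

end Hull

section Layer

variable {ι : Type*} (Ei : ι → IntermediateField ℚ ℂ) (E' : IntermediateField ℚ ℂ)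
  (hE : (⨅ i, Ei i) ≤ E') (hi : ∀ i, Ei i ≤ E')

/-! ## §2 The layer `L := E′` over `k := ⨅ Eᵢ`: finite, Galois, countable -/

/-- **The layer is countable**: `#↥(extendScalars hE) ≤ ℵ₀` (a number field has a finite `ℚ`-basis, and `ℚ` is countable).
[cite: Lang2002, Ch. VIII §1] -/
theorem Complex.cardinalMk_extendScalars_le_aleph0 [FiniteDimensional ℚ E'] : #↥(extendScalars hE) ≤ ℵ₀ := by
  obtain ⟨e⟩ := Complex.nonempty_algEquiv_extendScalars_iInf Ei E' hE
  haveI : FiniteDimensional ℚ ↥(extendScalars hE) := LinearEquiv.finiteDimensional e.toLinearEquiv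
  haveI : Countable ↥(extendScalars hE) :=
    Countable.of_equiv _ (Module.finBasis ℚ ↥(extendScalars hE)).equivFun.toEquiv.symm
  exact Cardinal.mk_le_aleph0

/-! ## §3 The middle inclusions `Eᵢ ↪ L` -/

/-- **The inclusion `incl i : Eᵢ →+* L`** of a member of the family into the layer `L = ↥(extendScalars hE)` (same complex numbers:
`Eᵢ ≤ E′`).  Plumbing definition (the crew installs `(incl i).toAlgebra` privately). [cite: Deligne1971TravauxShimura, Prop. 5.10 proof (p. 157)] -/
def Complex.inclExtendScalars (i : ι) : ↥(Ei i) →+* ↥(extendScalars hE) where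
  toFun x := ⟨(x : ℂ), (mem_extendScalars hE).2 (hi i x.2)⟩
  map_one' := rfl
  map_mul' _ _ := rfl
  map_zero' := rfl
  map_add' _ _ := rfl

/-- `incl i` is the identity on complex numbers: `((incl i x : L) : ℂ) = x`. [cite: Deligne1971TravauxShimura, Prop. 5.10 proof (p. 157)] -/
@[simp]
theorem Complex.coe_inclExtendScalars_apply (i : ι) (x : ↥(Ei i)) :
    ((Complex.inclExtendScalars Ei E' hE hi i x : ↥(extendScalars hE)) : ℂ) = x := rfl

/-- `incl i` is injective. [cite: Deligne1971TravauxShimura, Prop. 5.10 proof (p. 157)] -/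
theorem Complex.inclExtendScalars_injective (i : ι) : Function.Injective (Complex.inclExtendScalars Ei E' hE hi i) :=
  fun _ _ h => Subtype.ext (congrArg (fun z : ↥(extendScalars hE) => (z : ℂ)) h)

/-- **Tower compatibility of `incl i`**: `algebraMap L ℂ ∘ incl i = algebraMap Eᵢ ℂ` — the equation that makes
`IsScalarTower ↥(Ei i) L ℂ` hold for the algebra structure `(incl i).toAlgebra` (`IsScalarTower.of_algebraMap_eq`).
[cite: Deligne1971TravauxShimura, Prop. 5.10 proof (p. 157)] -/
theorem Complex.algebraMap_comp_inclExtendScalars (i : ι) :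
    (algebraMap ↥(extendScalars hE) ℂ).comp (Complex.inclExtendScalars Ei E' hE hi i) = algebraMap ↥(Ei i) ℂ := rfl

/-- The scalar tower `Eᵢ → L → ℂ` for the algebra structure `(incl i).toAlgebra` (stated with the structure as a `letI`, not
installed as an instance). [cite: Deligne1971TravauxShimura, Prop. 5.10 proof (p. 157)] -/
theorem Complex.isScalarTower_inclExtendScalars (i : ι) :
    letI : Algebra ↥(Ei i) ↥(extendScalars hE) := (Complex.inclExtendScalars Ei E' hE hi i).toAlgebra
    IsScalarTower ↥(Ei i) ↥(extendScalars hE) ℂ :=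
  letI : Algebra ↥(Ei i) ↥(extendScalars hE) := (Complex.inclExtendScalars Ei E' hE hi i).toAlgebra
  IsScalarTower.of_algebraMap_eq fun _ => rfl

/-- `incl i` commutes with the structure maps from `k = ⨅ Eᵢ`: `incl i (x) = algebraMap k L x` for `x ∈ ⨅ Eᵢ ≤ Eᵢ`
(both are `x` as a complex number). [cite: Deligne1971TravauxShimura, Prop. 5.10 proof (p. 157)] -/
theorem Complex.inclExtendScalars_inclusion (i : ι) (x : ↥(⨅ i, Ei i)) :
    Complex.inclExtendScalars Ei E' hE hi i (IntermediateField.inclusion (iInf_le Ei i) x) =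
      algebraMap ↥(⨅ i, Ei i) ↥(extendScalars hE) x :=
  Subtype.ext rfl

/-! ## §4 The subgroups `Hᵢ = Gal(L/Eᵢ ∩ E′)` and their generation of `Gal(L/k)` -/

/-- **`H i ≤ Gal(L/k)`**, the subgroup fixing the trace of `Eᵢ` pointwise: Mathlib's `fixingSubgroup` of the intermediate field
`Eᵢ ∩ E′` of `L/k` (the comap of `extendScalars (⨅ ≤ Eᵢ)` along `L ↪ ℂ`).  Plumbing definition.
[cite: Deligne1971TravauxShimura, Prop. 5.10 proof (p. 157): «Gal(F/Eᵢ)»] -/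
def Complex.traceFixingSubgroup (i : ι) :
    Subgroup (↥(extendScalars hE) ≃ₐ[↥(⨅ i, Ei i)] ↥(extendScalars hE)) :=
  ((extendScalars (iInf_le Ei i) : IntermediateField ↥(⨅ i, Ei i) ℂ).comap (extendScalars hE).val).fixingSubgroup

/-- **Membership criterion for `H i`** in the crew's currency: `γ ∈ H i ↔ ∀ x : Eᵢ, γ (incl i x) = incl i x`.
[cite: Deligne1971TravauxShimura, Prop. 5.10 proof (p. 157)] -/
theorem Complex.mem_traceFixingSubgroup_iff (i : ι) (γ : ↥(extendScalars hE) ≃ₐ[↥(⨅ i, Ei i)] ↥(extendScalars hE)) :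
    γ ∈ Complex.traceFixingSubgroup Ei E' hE i ↔
      ∀ x : ↥(Ei i), γ (Complex.inclExtendScalars Ei E' hE hi i x) = Complex.inclExtendScalars Ei E' hE hi i x := by
  rw [Complex.traceFixingSubgroup, Complex.mem_fixingSubgroup_comap_extendScalars_iff]
  constructor
  · intro h x
    exact Subtype.ext (h (Complex.inclExtendScalars Ei E' hE hi i x) x.2)
  · intro h y hy
    exact congrArg (fun z : ↥(extendScalars hE) => (z : ℂ)) (h ⟨(y : ℂ), hy⟩)

/-- Membership criterion for `H i`, complex-number form: `γ ∈ H i ↔ ∀ x : L, (x : ℂ) ∈ Eᵢ → (γ x : ℂ) = x`.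
[cite: Deligne1971TravauxShimura, Prop. 5.10 proof (p. 157)] -/
theorem Complex.mem_traceFixingSubgroup_iff' (i : ι) (γ : ↥(extendScalars hE) ≃ₐ[↥(⨅ i, Ei i)] ↥(extendScalars hE)) :
    γ ∈ Complex.traceFixingSubgroup Ei E' hE i ↔
      ∀ x : ↥(extendScalars hE), (x : ℂ) ∈ Ei i → ((γ x : ↥(extendScalars hE)) : ℂ) = x :=
  Complex.mem_fixingSubgroup_comap_extendScalars_iff Ei E' hE i γ

/-- **The `H i` generate `Gal(L/k)`**: `⨆ i, H i = ⊤` ([Deligne1971TravauxShimura] p. 157: «`Gal(F/E)` est engendré par les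
`Gal(F/Eᵢ)`» — Galois correspondence over `k = ⨅ Eᵢ`, `⨅ (Eᵢ ∩ E′) = k`). [cite: Deligne1971TravauxShimura, Prop. 5.10 and Lemme 5.10.1 (pp. 157–158)]
[cite: Lang2002, Ch. VI §1 Cor. 1.6] -/
theorem Complex.iSup_traceFixingSubgroup_eq_top [FiniteDimensional ℚ E'] [IsGalois ℚ E'] :
    ⨆ i, Complex.traceFixingSubgroup Ei E' hE i = ⊤ := by
  haveI := Complex.finiteDimensional_extendScalars_iInf Ei E' hE
  haveI := Complex.isGalois_extendScalars_iInf Ei E' hE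
  exact IntermediateField.iSup_fixingSubgroup_eq_top_of_iInf_eq_bot _ (Complex.iInf_comap_extendScalars_eq_bot Ei E' hE)

/-- **Word principle in the `incl` currency**: a predicate on `Gal(L/k)` holding at `1`, stable under products, and holding for every
`γ` with `∀ x : Eᵢ, γ (incl i x) = incl i x` for SOME `i`, holds everywhere. [cite: Deligne1971TravauxShimura, Lemme 5.10.1 (p. 157)] -/
theorem Complex.gal_incl_induction [FiniteDimensional ℚ E'] [IsGalois ℚ E']
    {P : (↥(extendScalars hE) ≃ₐ[↥(⨅ i, Ei i)] ↥(extendScalars hE)) → Prop} (one : P 1)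
    (mul : ∀ σ ρ, P σ → P ρ → P (σ * ρ))
    (base : ∀ (i : ι) (γ : ↥(extendScalars hE) ≃ₐ[↥(⨅ i, Ei i)] ↥(extendScalars hE)),
      (∀ x : ↥(Ei i), γ (Complex.inclExtendScalars Ei E' hE hi i x) = Complex.inclExtendScalars Ei E' hE hi i x) → P γ)
    (γ : ↥(extendScalars hE) ≃ₐ[↥(⨅ i, Ei i)] ↥(extendScalars hE)) : P γ :=
  Complex.gal_extendScalars_iInf_induction Ei E' hE one mul
    (fun i γ hγ => base i γ fun x => Subtype.ext (hγ (Complex.inclExtendScalars Ei E' hE hi i x) x.2)) γ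

/-! ## §5 Extension to `ℂ` and restriction from `ℂ` -/

/-- **`hext`: every `γ ∈ Gal(L/k)` extends to a ring automorphism of `ℂ`** (P0, `Complex.exists_ringEquiv_apply_eq_extendScalars`),
in the crew's spelling `σ (algebraMap L ℂ x) = algebraMap L ℂ (γ x)`. [cite: Lang2002, Ch. VIII §1 Thm. 1.1 with Ch. V §2 Thm. 2.8] -/
theorem Complex.exists_ringEquiv_extends (γ : ↥(extendScalars hE) ≃ₐ[↥(⨅ i, Ei i)] ↥(extendScalars hE)) :
    ∃ σ : ℂ ≃+* ℂ, ∀ x : ↥(extendScalars hE),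
      σ (algebraMap ↥(extendScalars hE) ℂ x) = algebraMap ↥(extendScalars hE) ℂ (γ x) := by
  obtain ⟨σ, -, hσ⟩ := Literature.FieldTheory.AlgClosed.Complex.exists_ringEquiv_apply_eq_extendScalars hE γ
  exact ⟨σ, hσ⟩

/-- The same with the `k`-fixing clause kept. [cite: Lang2002, Ch. VIII §1 Thm. 1.1 with Ch. V §2 Thm. 2.8] -/
theorem Complex.exists_ringEquiv_extends_fix (γ : ↥(extendScalars hE) ≃ₐ[↥(⨅ i, Ei i)] ↥(extendScalars hE)) :
    ∃ σ : ℂ ≃+* ℂ, (∀ x : ↥(⨅ i, Ei i), σ x = x) ∧ ∀ x : ↥(extendScalars hE),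
      σ (algebraMap ↥(extendScalars hE) ℂ x) = algebraMap ↥(extendScalars hE) ℂ (γ x) :=
  Literature.FieldTheory.AlgClosed.Complex.exists_ringEquiv_apply_eq_extendScalars hE γ

/-- **`hres`: every `σ̃ ∈ Aut(ℂ/k)` restricts to some `γ ∈ Gal(L/k)`** — `E′/ℚ` is normal, so `σ̃(E′) = E′` (Mathlib
`AlgEquiv.restrictNormal`), and the restriction fixes `k` because `σ̃` does. [cite: Lang2002, Ch. V §3 Thm. 3.3 (normal extensions are
stable under embeddings)] -/
theorem Complex.exists_algEquiv_restricts [Normal ℚ E'] (σ : ℂ ≃ₐ[↥(⨅ i, Ei i)] ℂ) :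
    ∃ γ : ↥(extendScalars hE) ≃ₐ[↥(⨅ i, Ei i)] ↥(extendScalars hE), ∀ x : ↥(extendScalars hE),
      σ (algebraMap ↥(extendScalars hE) ℂ x) = algebraMap ↥(extendScalars hE) ℂ (γ x) := by
  -- restrict the `ℚ`-automorphism underlying `σ` to the normal subextension `E'`
  let σ₀ : ℂ ≃ₐ[ℚ] ℂ := σ.restrictScalars ℚ
  let γ₀ : ↥E' ≃ₐ[ℚ] ↥E' := σ₀.restrictNormal ↥E'
  have hγ₀ : ∀ x : ↥E', ((γ₀ x : ↥E') : ℂ) = σ x := fun x => AlgEquiv.restrictNormal_commutes σ₀ ↥E' x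
  -- transport to the carrier `extendScalars hE` and upgrade to a `k`-algebra automorphism
  refine ⟨{ toFun := fun x => ⟨(γ₀ ⟨x.1, (mem_extendScalars hE).1 x.2⟩ : ↥E'), (mem_extendScalars hE).2 (γ₀ _).2⟩
            invFun := fun x => ⟨(γ₀.symm ⟨x.1, (mem_extendScalars hE).1 x.2⟩ : ↥E'), (mem_extendScalars hE).2 (γ₀.symm _).2⟩
            left_inv := fun x => Subtype.ext (by simp)
            right_inv := fun x => Subtype.ext (by simp)
            map_mul' := fun x y => Subtype.ext (by
              change ((γ₀ (⟨x.1, _⟩ * ⟨y.1, _⟩) : ↥E') : ℂ) = _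
              rw [map_mul]; rfl)
            map_add' := fun x y => Subtype.ext (by
              change ((γ₀ (⟨x.1, _⟩ + ⟨y.1, _⟩) : ↥E') : ℂ) = _
              rw [map_add]; rfl)
            commutes' := fun x => Subtype.ext (by
              change ((γ₀ ⟨(x : ℂ), _⟩ : ↥E') : ℂ) = (x : ℂ)
              rw [hγ₀]
              exact σ.commutes x) }, fun x => ?_⟩
  change σ (x : ℂ) = ((γ₀ ⟨x.1, _⟩ : ↥E') : ℂ)
  rw [hγ₀]

end Layer

end Literature.FieldTheory.Galois

end
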